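import Summits.Ventures.PercRepro.ProfilePointedSeqConv

/-!
# PercRepro — THE ARITHMETIC HALF OF «(Ĉ) IS CLOSED UNDER DIRECT SUMS», I: BOOKKEEPING AND THE IDENTITY (7.2)
(p10, gen 23; `proofs/P10-COLOOPEXT-g22.md` §7.2, §7.4)

`ProfilePointedSeqConv.lean` states the sequence-level theorem as the `Prop` `SeqPointedConv` (NOT asserted there).
This file is the first half of its proof (the second, `ProfilePointedSeqConvProof.lean`, proves `seqPointedConv_holds`):

* finite-sum bookkeeping on `ℤ` — a sum is unchanged by enlarging its range over zeros (`sum_eq_sum_of_support`), the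
  reflection `i ↦ C − i` of `Icc lo hi`, `C = lo + hi` (`sum_Icc_reflect`), and the SYMMETRISATION that replaces the
  paper's fold: for `g` antisymmetric under the reflection, `2 · Σ g i · h i = Σ g i · (h i − h (C − i))`
  (`two_mul_sum_eq_sum_sub`), whose summands are mirror-invariant (`term_reflect`); a mirrored pair can be extracted
  from such a sum when every other summand is non-negative (`two_mul_term_le_sum`);
* the WEAK monotone-pair lemma on zero-extended `ℤ → ℚ` sequences, `y < x`, `x + y + 1 ≤ L ⟹ f y ≤ f x`
  (`pair_le_of_chain_int`, from the landed `monotone_pair_of_chain`), and `f 0 ≤ f x` on `[0, L]` (`zero_le_of_chain_int`);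
* the three sequences of (7.2) — the (Ĉ)-defect `D` of `(P, c)`, the Theorem-A slack `α` of `a`, the weight
  `W j = (N₂ − 2j)·a j` — with their antisymmetries `D (N₁ − 1 − i) = −D i`, `α (N₂ − 1 − j) = −α j`,
  `W (N₂ − j) = −W j`, their boundary values `D (−1) = −P 0`, `D N₁ = P 0`, and their supports;
* THE IDENTITY (7.2) itself (`seq_identity`): the (Ĉ)-defect of the convolutions at level `k` is
  `Σ_j D (k − j)·a j + Σ_j α j·P (k − j) + Σ_j W j·c (k − j)`, by a termwise expansion and ONE index shift `j ↦ j + 1`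
  (`sum_shift_slack`); and the two range changes (`sum_defect_range`, `sum_slack_range`) that put the defect sum on its
  symmetric range `Icc (k − N₁) (k + 1)` and drop the vanishing top term `α N₂` of the slack sum.

Nothing here asserts (Ĉ).
-/

namespace PercRepro.Cogirth

open Finset

/-! ### Finite-sum bookkeeping on `ℤ` -/

/-- Two sums of the same summand agree when it vanishes outside both index sets. -/
theorem sum_eq_sum_of_support {F : ℤ → ℚ} {A B : Finset ℤ} (hA : ∀ i, i ∉ A → F i = 0)
    (hB : ∀ i, i ∉ B → F i = 0) : ∑ i ∈ A, F i = ∑ i ∈ B, F i := by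
  rw [Finset.sum_subset (Finset.subset_union_left (s₂ := B)) (fun i _ hi => hA i hi),
    Finset.sum_subset (Finset.subset_union_right (s₁ := A)) (fun i _ hi => hB i hi)]

/-- Reflection of a sum over `Icc lo hi` through `i ↦ C − i`, `C = lo + hi`. -/
theorem sum_Icc_reflect (lo hi C : ℤ) (hC : lo + hi = C) (F : ℤ → ℚ) :
    ∑ i ∈ Icc lo hi, F i = ∑ i ∈ Icc lo hi, F (C - i) := by
  apply Finset.sum_nbij' (fun i => C - i) (fun i => C - i)
  · intro i hi; simp only [mem_Icc] at hi ⊢; omega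
  · intro i hi; simp only [mem_Icc] at hi ⊢; omega
  · intro i _; ring
  · intro i _; ring
  · intro i _
    show F i = F (C - (C - i))
    congr 1
    ring

/-- **Symmetrisation**: for `g` antisymmetric under `i ↦ C − i` (`C = lo + hi`), twice the sum of `g · h` over
`Icc lo hi` is the sum of `g i · (h i − h (C − i))`. -/
theorem two_mul_sum_eq_sum_sub (lo hi C : ℤ) (hC : lo + hi = C) (g h : ℤ → ℚ)
    (hg : ∀ i, g (C - i) = - g i) :
    2 * ∑ i ∈ Icc lo hi, g i * h i = ∑ i ∈ Icc lo hi, g i * (h i - h (C - i)) := by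
  have h1 : ∑ i ∈ Icc lo hi, g i * h i = - ∑ i ∈ Icc lo hi, g i * h (C - i) := by
    rw [sum_Icc_reflect lo hi C hC (fun i => g i * h i), ← Finset.sum_neg_distrib]
    apply Finset.sum_congr rfl
    intro i _
    show g (C - i) * h (C - i) = -(g i * h (C - i))
    rw [hg]
    ring
  have h2 : ∑ i ∈ Icc lo hi, g i * (h i - h (C - i)) =
      ∑ i ∈ Icc lo hi, g i * h i - ∑ i ∈ Icc lo hi, g i * h (C - i) := by
    rw [← Finset.sum_sub_distrib]
    apply Finset.sum_congr rfl
    intro i _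
    ring
  rw [h2]
  linarith [h1]

/-- The symmetrised summand is invariant under the mirror `i ↦ C − i`. -/
theorem term_reflect (C : ℤ) (g h : ℤ → ℚ) (hg : ∀ i, g (C - i) = - g i) (i : ℤ) :
    g (C - i) * (h (C - i) - h (C - (C - i))) = g i * (h i - h (C - i)) := by
  rw [hg, show C - (C - i) = i by ring]
  ring

/-- **Extracting a mirrored pair**: if every summand of the symmetrised sum other than those at `j` and `C − j`
is non-negative, the sum is at least twice the summand at `j`. -/
theorem two_mul_term_le_sum (lo hi C : ℤ) (hC : lo + hi = C) (g h : ℤ → ℚ)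
    (hg : ∀ i, g (C - i) = - g i) (j : ℤ)
    (hnn : ∀ i, lo ≤ i → i ≤ hi → i ≠ j → i ≠ C - j → 0 ≤ g i * (h i - h (C - i)))
    (hj0 : lo ≤ j) (hj1 : j ≤ hi) (hne : j ≠ C - j) :
    2 * (g j * (h j - h (C - j))) ≤ ∑ i ∈ Icc lo hi, g i * (h i - h (C - i)) := by
  have hsub : ({j, C - j} : Finset ℤ) ⊆ Icc lo hi := by
    intro i hi
    simp only [mem_insert, mem_singleton] at hi
    simp only [mem_Icc]
    rcases hi with rfl | rfl <;> omega
  calc 2 * (g j * (h j - h (C - j)))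
      = ∑ i ∈ ({j, C - j} : Finset ℤ), g i * (h i - h (C - i)) := by
        rw [Finset.sum_pair hne, term_reflect C g h hg j]
        ring
    _ ≤ ∑ i ∈ Icc lo hi, g i * (h i - h (C - i)) := by
        apply Finset.sum_le_sum_of_subset_of_nonneg hsub
        intro i hi hni
        simp only [mem_insert, mem_singleton, not_or] at hni
        exact hnn i (mem_Icc.1 hi).1 (mem_Icc.1 hi).2 hni.1 hni.2

/-! ### The weak monotone-pair lemma on `ℤ` (from the landed `monotone_pair_of_chain`) -/

/-- `C(L, ·)` compares along a pair `y < x`, `x + y + 1 ≤ L`: `C(L, y) ≤ C(L, x)`. -/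
theorem choose_le_choose_of_pair {L x y : ℕ} (hyx : y < x) (hxy : x + y + 1 ≤ L) :
    Nat.choose L y ≤ Nat.choose L x := by
  by_cases hx : 2 * x ≤ L
  · exact choose_le_choose_of_le_half (le_of_lt hyx) hx
  · have hxL : x ≤ L := by omega
    rw [← Nat.choose_symm hxL]
    exact choose_le_choose_of_le_half (by omega) (by omega)

/-- **The monotone-pair lemma, weak `ℤ` form**: for `f : ℤ → ℚ` vanishing below `0`, symmetric about `L / 2`
(`f (L − i) = f i`), non-negative and Theorem-A below the middle, and integers `y < x` with `x + y + 1 ≤ L`: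
`f y ≤ f x`. -/
theorem pair_le_of_chain_int (L : ℤ) (f : ℤ → ℚ) (hz : ∀ i, i < 0 → f i = 0)
    (hsym : ∀ i, f (L - i) = f i) (hnn : ∀ i, 0 ≤ f i)
    (hA : ∀ i : ℤ, 0 ≤ i → 2 * i + 2 ≤ L → ((L : ℚ) - i) * f i ≤ (i + 1) * f (i + 1))
    {x y : ℤ} (hyx : y < x) (hxy : x + y + 1 ≤ L) : f y ≤ f x := by
  rcases lt_or_ge y 0 with hy | hy
  · rw [hz y hy]
    exact hnn x
  have hL : 0 ≤ L := by omega
  obtain ⟨Ln, hLn⟩ : ∃ Ln : ℕ, L = Ln := ⟨L.toNat, (Int.toNat_of_nonneg hL).symm⟩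
  obtain ⟨xn, hxn⟩ : ∃ xn : ℕ, x = xn := ⟨x.toNat, (Int.toNat_of_nonneg (by omega)).symm⟩
  obtain ⟨yn, hyn⟩ : ∃ yn : ℕ, y = yn := ⟨y.toNat, (Int.toNat_of_nonneg hy).symm⟩
  subst hLn hxn hyn
  have hf : ∀ j : ℕ, 2 * j + 2 ≤ Ln →
      ((Ln : ℚ) - j) * (fun n : ℕ => f n) j ≤ (j + 1) * (fun n : ℕ => f n) (j + 1) := by
    intro j hj
    have := hA j (by positivity) (by exact_mod_cast hj)
    simp only
    push_cast at this ⊢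
    exact this
  have hsymm : ∀ j : ℕ, j ≤ Ln → (fun n : ℕ => f n) (Ln - j) = (fun n : ℕ => f n) j := by
    intro j hj
    simp only
    rw [Nat.cast_sub hj]
    exact hsym j
  have key := monotone_pair_of_chain hf hsymm (x := xn) (y := yn) (by exact_mod_cast hyx)
    (by exact_mod_cast hxy)
  have hcc : (Nat.choose Ln yn : ℚ) ≤ Nat.choose Ln xn := by
    exact_mod_cast choose_le_choose_of_pair (by exact_mod_cast hyx) (by exact_mod_cast hxy)
  have h0 : 0 ≤ f 0 := hnn 0
  have hprod : 0 ≤ ((Nat.choose Ln xn : ℚ) - Nat.choose Ln yn) * f 0 := mul_nonneg (by linarith) h0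
  simp only [Nat.cast_zero] at key
  linarith

/-- `f 0 ≤ f x` on the whole range `0 ≤ x ≤ L` (the chain from `0`, or symmetry at the top). -/
theorem zero_le_of_chain_int (L : ℤ) (f : ℤ → ℚ) (hz : ∀ i, i < 0 → f i = 0)
    (hsym : ∀ i, f (L - i) = f i) (hnn : ∀ i, 0 ≤ f i)
    (hA : ∀ i : ℤ, 0 ≤ i → 2 * i + 2 ≤ L → ((L : ℚ) - i) * f i ≤ (i + 1) * f (i + 1))
    {x : ℤ} (hx0 : 0 ≤ x) (hxL : x ≤ L) : f 0 ≤ f x := by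
  rcases eq_or_lt_of_le hx0 with h | h
  · rw [← h]
  · rcases eq_or_lt_of_le hxL with h' | h'
    · have := hsym 0
      rw [sub_zero] at this
      rw [h', this]
    · exact pair_le_of_chain_int L f hz hsym hnn hA h (by omega)

/-! ### The three sequences of the identity (7.2) and their antisymmetries -/

/-- The (Ĉ)-defect of `(P, c)` on `N₁` elements at level `i`, for every integer `i` (zero-extended sequences):
`i·P_{i+1} + (N₁ − 2i − 1)·c_i − (N₁ − i − 1)·P_i`. -/
def seqDefect (N₁ : ℕ) (P c : ℤ → ℚ) (i : ℤ) : ℚ :=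
  i * P (i + 1) + ((N₁ : ℚ) - 2 * i - 1) * c i - ((N₁ : ℚ) - i - 1) * P i

/-- The Theorem-A slack of `a` on `N₂` elements at level `j`: `(j + 1)·a_{j+1} − (N₂ − j)·a_j`. -/
def seqSlack (N₂ : ℕ) (a : ℤ → ℚ) (j : ℤ) : ℚ := (j + 1) * a (j + 1) - ((N₂ : ℚ) - j) * a j

/-- The antisymmetric weight `(N₂ − 2j)·a_j`. -/
def seqWeight (N₂ : ℕ) (a : ℤ → ℚ) (j : ℤ) : ℚ := ((N₂ : ℚ) - 2 * j) * a j

/-- `D` is antisymmetric about `(N₁ − 1) / 2`: `D (N₁ − 1 − i) = −D i`. -/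
theorem seqDefect_reflect (N₁ : ℕ) (P c : ℤ → ℚ) (hPs : ∀ i, P ((N₁ : ℤ) - i) = P i)
    (hcs : ∀ i, c ((N₁ : ℤ) - 1 - i) = c i) (i : ℤ) :
    seqDefect N₁ P c ((N₁ : ℤ) - 1 - i) = - seqDefect N₁ P c i := by
  unfold seqDefect
  have h1 : P ((N₁ : ℤ) - 1 - i + 1) = P i := by
    rw [show (N₁ : ℤ) - 1 - i + 1 = (N₁ : ℤ) - i by ring]
    exact hPs i
  have h2 : P ((N₁ : ℤ) - 1 - i) = P (i + 1) := by
    rw [show (N₁ : ℤ) - 1 - i = (N₁ : ℤ) - (i + 1) by ring]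
    exact hPs (i + 1)
  rw [h1, h2, hcs i]
  push_cast
  ring

/-- `α` is antisymmetric about `(N₂ − 1) / 2`: `α (N₂ − 1 − j) = −α j`. -/
theorem seqSlack_reflect (N₂ : ℕ) (a : ℤ → ℚ) (has : ∀ j, a ((N₂ : ℤ) - j) = a j) (j : ℤ) :
    seqSlack N₂ a ((N₂ : ℤ) - 1 - j) = - seqSlack N₂ a j := by
  unfold seqSlack
  have h1 : a ((N₂ : ℤ) - 1 - j + 1) = a j := by
    rw [show (N₂ : ℤ) - 1 - j + 1 = (N₂ : ℤ) - j by ring]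
    exact has j
  have h2 : a ((N₂ : ℤ) - 1 - j) = a (j + 1) := by
    rw [show (N₂ : ℤ) - 1 - j = (N₂ : ℤ) - (j + 1) by ring]
    exact has (j + 1)
  rw [h1, h2]
  push_cast
  ring

/-- `W` is antisymmetric about `N₂ / 2`: `W (N₂ − j) = −W j`. -/
theorem seqWeight_reflect (N₂ : ℕ) (a : ℤ → ℚ) (has : ∀ j, a ((N₂ : ℤ) - j) = a j) (j : ℤ) :
    seqWeight N₂ a ((N₂ : ℤ) - j) = - seqWeight N₂ a j := by
  unfold seqWeight
  rw [has j]
  push_cast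
  ring

/-- `D (−1) = −P 0`. -/
theorem seqDefect_neg_one (N₁ : ℕ) (P c : ℤ → ℚ) (hP0 : ∀ i, i < 0 → P i = 0)
    (hc0 : ∀ i, i < 0 → c i = 0) : seqDefect N₁ P c (-1) = - P 0 := by
  unfold seqDefect
  rw [hc0 (-1) (by omega), hP0 (-1) (by omega)]
  norm_num

/-- `D N₁ = P 0`. -/
theorem seqDefect_top (N₁ : ℕ) (P c : ℤ → ℚ) (hP1 : ∀ i, (N₁ : ℤ) < i → P i = 0)
    (hPs : ∀ i, P ((N₁ : ℤ) - i) = P i) (hc1 : ∀ i, (N₁ : ℤ) - 1 < i → c i = 0) :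
    seqDefect N₁ P c N₁ = P 0 := by
  unfold seqDefect
  have h0 : P N₁ = P 0 := by
    have := hPs 0
    rwa [sub_zero] at this
  rw [hP1 ((N₁ : ℤ) + 1) (by omega), hc1 N₁ (by omega), h0]
  push_cast
  ring

/-- `D i = 0` for `i ≤ −2`. -/
theorem seqDefect_eq_zero_of_lt (N₁ : ℕ) (P c : ℤ → ℚ) (hP0 : ∀ i, i < 0 → P i = 0)
    (hc0 : ∀ i, i < 0 → c i = 0) {i : ℤ} (hi : i < -1) : seqDefect N₁ P c i = 0 := by
  unfold seqDefect
  rw [hP0 (i + 1) (by omega), hc0 i (by omega), hP0 i (by omega)]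
  ring

/-- `D i = 0` for `i ≥ N₁ + 1`. -/
theorem seqDefect_eq_zero_of_gt (N₁ : ℕ) (P c : ℤ → ℚ) (hP1 : ∀ i, (N₁ : ℤ) < i → P i = 0)
    (hc1 : ∀ i, (N₁ : ℤ) - 1 < i → c i = 0) {i : ℤ} (hi : (N₁ : ℤ) < i) : seqDefect N₁ P c i = 0 := by
  unfold seqDefect
  rw [hP1 (i + 1) (by omega), hc1 i (by omega), hP1 i hi]
  ring

/-- `α N₂ = 0`. -/
theorem seqSlack_top (N₂ : ℕ) (a : ℤ → ℚ) (ha1 : ∀ j, (N₂ : ℤ) < j → a j = 0) :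
    seqSlack N₂ a N₂ = 0 := by
  unfold seqSlack
  rw [ha1 ((N₂ : ℤ) + 1) (by omega)]
  push_cast
  ring

/-! ### The identity (7.2) -/

/-- The index shift `j ↦ j + 1`: `Σ_j j·a_j·P_{k+1−j} = Σ_j (j + 1)·a_{j+1}·P_{k−j}` over `Icc 0 N₂`
(the `j = 0` term and the `a_{N₂+1}` term vanish). -/
theorem sum_shift_slack (N₂ : ℕ) (a P : ℤ → ℚ) (ha0 : ∀ j, j < 0 → a j = 0)
    (ha1 : ∀ j, (N₂ : ℤ) < j → a j = 0) (k : ℤ) :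
    ∑ j ∈ Icc (0 : ℤ) N₂, (j : ℚ) * a j * P (k + 1 - j) =
      ∑ j ∈ Icc (0 : ℤ) N₂, ((j : ℚ) + 1) * a (j + 1) * P (k - j) := by
  have h1 : ∑ j ∈ Icc (0 : ℤ) N₂, ((j : ℚ) + 1) * a (j + 1) * P (k - j) =
      ∑ j ∈ Icc (1 : ℤ) ((N₂ : ℤ) + 1), (j : ℚ) * a j * P (k + 1 - j) := by
    apply Finset.sum_nbij' (fun j => j + 1) (fun j => j - 1)
    · intro j hj; simp only [mem_Icc] at hj ⊢; omega
    · intro j hj; simp only [mem_Icc] at hj ⊢; omega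
    · intro j _; ring
    · intro j _; ring
    · intro j _
      show ((j : ℚ) + 1) * a (j + 1) * P (k - j) = ((j + 1 : ℤ) : ℚ) * a (j + 1) * P (k + 1 - (j + 1))
      rw [show k + 1 - (j + 1) = k - j by ring]
      push_cast
      ring
  rw [h1]
  apply sum_eq_sum_of_support
  · intro j hj
    simp only [mem_Icc, not_and_or, not_le] at hj
    rcases hj with hj | hj
    · rw [ha0 j hj]; ring
    · rw [ha1 j hj]; ring
  · intro j hj
    simp only [mem_Icc, not_and_or, not_le] at hj
    rcases hj with hj | hj
    · rcases eq_or_lt_of_le (show j ≤ 0 by omega) with h | h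
      · rw [h]; simp
      · rw [ha0 j h]; ring
    · rw [ha1 j (by omega)]; ring

/-- **THE IDENTITY (7.2)**: the (Ĉ)-defect of the convolutions at level `k` equals
`Σ_j D (k − j)·a_j + Σ_j α j·P (k − j) + Σ_j W j·c (k − j)` (all over `Icc 0 N₂`). -/
theorem seq_identity (N₁ N₂ : ℕ) (P c a : ℤ → ℚ) (ha0 : ∀ j, j < 0 → a j = 0)
    (ha1 : ∀ j, (N₂ : ℤ) < j → a j = 0) (k : ℤ) :
    k * (∑ j ∈ Finset.Icc (0 : ℤ) N₂, a j * P (k + 1 - j)) +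
        ((N₁ + N₂ : ℚ) - 2 * k - 1) * (∑ j ∈ Finset.Icc (0 : ℤ) N₂, a j * c (k - j)) -
      ((N₁ + N₂ : ℚ) - k - 1) * (∑ j ∈ Finset.Icc (0 : ℤ) N₂, a j * P (k - j)) =
    ∑ j ∈ Icc (0 : ℤ) N₂, seqDefect N₁ P c (k - j) * a j +
      ∑ j ∈ Icc (0 : ℤ) N₂, seqSlack N₂ a j * P (k - j) +
        ∑ j ∈ Icc (0 : ℤ) N₂, seqWeight N₂ a j * c (k - j) := by
  have hA : k * (∑ j ∈ Finset.Icc (0 : ℤ) N₂, a j * P (k + 1 - j)) +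
        ((N₁ + N₂ : ℚ) - 2 * k - 1) * (∑ j ∈ Finset.Icc (0 : ℤ) N₂, a j * c (k - j)) -
      ((N₁ + N₂ : ℚ) - k - 1) * (∑ j ∈ Finset.Icc (0 : ℤ) N₂, a j * P (k - j)) =
      ∑ j ∈ Icc (0 : ℤ) N₂, (seqDefect N₁ P c (k - j) * a j +
        ((j : ℚ) * a j * P (k + 1 - j) - ((N₂ : ℚ) - j) * a j * P (k - j)) +
          seqWeight N₂ a j * c (k - j)) := by
    rw [Finset.mul_sum, Finset.mul_sum, Finset.mul_sum, ← Finset.sum_add_distrib,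
      ← Finset.sum_sub_distrib]
    apply Finset.sum_congr rfl
    intro j _
    unfold seqDefect seqWeight
    rw [show k - j + 1 = k + 1 - j by ring]
    push_cast
    ring
  rw [hA, Finset.sum_add_distrib, Finset.sum_add_distrib, Finset.sum_sub_distrib, sum_shift_slack N₂ a P ha0 ha1 k,
    ← Finset.sum_sub_distrib]
  congr 2
  apply Finset.sum_congr rfl
  intro j _
  unfold seqSlack
  ring

/-! ### Ranges: the defect sum on its symmetric range, the slack sum without its vanishing top term -/

/-- The defect sum over `Icc 0 N₂` equals the same sum over `Icc (k − N₁) (k + 1)` (the support of `D (k − ·)`). -/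
theorem sum_defect_range (N₁ N₂ : ℕ) (P c a : ℤ → ℚ) (hP0 : ∀ i, i < 0 → P i = 0)
    (hP1 : ∀ i, (N₁ : ℤ) < i → P i = 0) (hc0 : ∀ i, i < 0 → c i = 0)
    (hc1 : ∀ i, (N₁ : ℤ) - 1 < i → c i = 0) (ha0 : ∀ j, j < 0 → a j = 0)
    (ha1 : ∀ j, (N₂ : ℤ) < j → a j = 0) (k : ℤ) :
    ∑ j ∈ Icc (0 : ℤ) N₂, seqDefect N₁ P c (k - j) * a j =
      ∑ j ∈ Icc (k - N₁) (k + 1), seqDefect N₁ P c (k - j) * a j := by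
  apply sum_eq_sum_of_support
  · intro j hj
    simp only [mem_Icc, not_and_or, not_le] at hj
    rcases hj with hj | hj
    · rw [ha0 j hj]; ring
    · rw [ha1 j hj]; ring
  · intro j hj
    simp only [mem_Icc, not_and_or, not_le] at hj
    rcases hj with hj | hj
    · rw [seqDefect_eq_zero_of_gt N₁ P c hP1 hc1 (by omega)]; ring
    · rw [seqDefect_eq_zero_of_lt N₁ P c hP0 hc0 (by omega)]; ring

/-- The slack sum over `Icc 0 N₂` equals the same sum over `Icc 0 (N₂ − 1)` (`α N₂ = 0`). -/
theorem sum_slack_range (N₂ : ℕ) (a P : ℤ → ℚ) (ha1 : ∀ j, (N₂ : ℤ) < j → a j = 0) (k : ℤ) :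
    ∑ j ∈ Icc (0 : ℤ) N₂, seqSlack N₂ a j * P (k - j) =
      ∑ j ∈ Icc (0 : ℤ) ((N₂ : ℤ) - 1), seqSlack N₂ a j * P (k - j) := by
  symm
  apply Finset.sum_subset (Finset.Icc_subset_Icc (le_refl _) (by omega))
  intro j hj hj'
  simp only [mem_Icc] at hj
  simp only [mem_Icc, not_and_or, not_le] at hj'
  have : j = N₂ := by omega
  rw [this, seqSlack_top N₂ a ha1]
  ring

end PercRepro.Cogirth
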